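import Summits.CriticalPhenomena.PercolationContinuityZ3.Theorems.PercNearOneGluingAdditiveGluingSetGlueK0
import Summits.CriticalPhenomena.PercolationContinuityZ3.Theorems.PercNearOneGluingAdditiveGluingSetGlueHalf
import HarnessLib

/-!
# Crux `PercNearOneGluing.AdditiveGluing` (stmt-CriticalPhenomena-4576): (K₀-set) ⟹ `AdditiveGluing`, closed form

Support file (`--supports stmt-CriticalPhenomena-4576`; lead-of-record prim-png-lead-4576, gen 2).  No definitions, no named facts,
no sorries.  Closing file of the set-gluing reduction (`…SetGluePullback.lean` p183711, `…SetGlueK0.lean` p184093, `…SetGlueHalf.lean`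
`setGlue_half` = the hypothesis `hHalf` of `additiveGluing_of_half_k0set2`): records the two final forms of the reduction:

* `k0set_pair_of_k0`, `k0set2_of_k0_k0set3` — the `|S| = 2` instances of (K₀-set) ARE the registered pair kernel `stub_k0_dp`
  (shape conversion), so (K₀) + (K₀-set)_{|S| ≥ 3} give (K₀-set)_{|S| ≥ 2}.
* `additiveGluing_of_k0set` — **(K₀-set) ⟹ `AdditiveGluing`**: ONE kernel for every number of relays
  (`μ(CSᶜ ∩ o↔c)·(G_S − μ(Γ_c)) ≤ μ(CSᶜ)·(G_S − μ(Γ_o))`, notation of `…SetGlueK0.lean`).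
* `additiveGluing_of_k0_k0set3` — **(K₀) [= `stub_k0_dp`, `|S| = 2`] + (K₀-set) [`|S| ≥ 3`] ⟹ `AdditiveGluing`**: the proposed
  two-stub skeleton v22 of line `tieline` (the ≥ 4-relay triple-tie stub `stub_additiveGluingTripleTieFour_c8` replaced by the
  `|S| ≥ 3` set kernel; no ties, no raises).
[cite: KozmaNitzan2024, Conjecture 1 (p. 3), Theorem 1 / (6) (pp. 7–8), Lemma 4 / (8)–(9) (pp. 9–10), Question 7 (p. 36), §5.3 (p. 34)]
[cite: VandenbergHaggstromKahn2005, Thms. 1.3–1.4]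
-/

namespace Summit.CriticalPhenomena.PercolationContinuityZ3.Theorems

open MeasureTheory Set Literature.Probability.LatticeModels Literature.Probability.Percolation

noncomputable section
open Classical

variable {n : ℕ}

/-- **The `|S| = 2` instances of (K₀-set) are the registered pair kernel (K₀)** (`stub_k0_dp` of line `tieline`, stated for
`(o, b, a₁, a₂, c)` with `τ_{a₂} ≤ τ_{a₁}`): with `S = {s₀, s₁}`, `s₀` the weaker relay, `CSᶜ = {c↮s₁} ∩ {c↮s₀}`, `BS = s₁↔b ∪ s₀↔b`, … .
Pure shape conversion (`⋃` over a two-element `Finset`). [cite: KozmaNitzan2024, Lemma 4 (p. 9)] -/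
theorem k0set_pair_of_k0
    (hK2 : ∀ (n : ℕ) (w : Sym2 (Fin n) → unitInterval) (o b a₁ a₂ c : Fin n),
      (prodBernoulli w).real (openConn a₂ b) ≤ (prodBernoulli w).real (openConn a₁ b) →
      (prodBernoulli w).real ((openConn c a₁)ᶜ ∩ (openConn c a₂)ᶜ ∩ openConn o c) *
          ((prodBernoulli w).real (openConn a₁ b ∪ openConn a₂ b) - (prodBernoulli w).real (openConn a₂ b) -
            (prodBernoulli w).real ((openConn c b)ᶜ ∩ (openConn c a₁ ∪ openConn c a₂) ∩ (openConn a₁ b ∪ openConn a₂ b))) ≤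
        (prodBernoulli w).real ((openConn c a₁)ᶜ ∩ (openConn c a₂)ᶜ : Set (BondConfig (Fin n))) *
          ((prodBernoulli w).real (openConn a₁ b ∪ openConn a₂ b) - (prodBernoulli w).real (openConn a₂ b) -
            (prodBernoulli w).real ((openConn o b)ᶜ ∩ (openConn o a₁ ∪ openConn o a₂) ∩ (openConn a₁ b ∪ openConn a₂ b))))
    (w : Sym2 (Fin n) → unitInterval) (o b c s₀ s₁ : Fin n)
    (hτ : (prodBernoulli w).real (openConn s₀ b) ≤ (prodBernoulli w).real (openConn s₁ b)) :
    (prodBernoulli w).real ((⋃ s ∈ ({s₀, s₁} : Finset (Fin n)), (openConn c s : Set (BondConfig (Fin n))))ᶜ ∩ openConn o c) *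
        ((prodBernoulli w).real (⋃ s ∈ ({s₀, s₁} : Finset (Fin n)), (openConn s b : Set (BondConfig (Fin n)))) -
          (prodBernoulli w).real (openConn s₀ b) -
          (prodBernoulli w).real ((openConn c b)ᶜ ∩ (⋃ s ∈ ({s₀, s₁} : Finset (Fin n)), (openConn c s : Set (BondConfig (Fin n)))) ∩
            (⋃ s ∈ ({s₀, s₁} : Finset (Fin n)), (openConn s b : Set (BondConfig (Fin n)))))) ≤
      (prodBernoulli w).real ((⋃ s ∈ ({s₀, s₁} : Finset (Fin n)), (openConn c s : Set (BondConfig (Fin n))))ᶜ) *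
        ((prodBernoulli w).real (⋃ s ∈ ({s₀, s₁} : Finset (Fin n)), (openConn s b : Set (BondConfig (Fin n)))) -
          (prodBernoulli w).real (openConn s₀ b) -
          (prodBernoulli w).real ((openConn o b)ᶜ ∩ (⋃ s ∈ ({s₀, s₁} : Finset (Fin n)), (openConn o s : Set (BondConfig (Fin n)))) ∩
            (⋃ s ∈ ({s₀, s₁} : Finset (Fin n)), (openConn s b : Set (BondConfig (Fin n)))))) := by
  have hU : ∀ (f : Fin n → Set (BondConfig (Fin n))), (⋃ s ∈ ({s₀, s₁} : Finset (Fin n)), f s) = f s₁ ∪ f s₀ := fun f => by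
    rw [Finset.set_biUnion_insert, Finset.set_biUnion_singleton, Set.union_comm]
  have hC : (⋃ s ∈ ({s₀, s₁} : Finset (Fin n)), (openConn c s : Set (BondConfig (Fin n))))ᶜ =
      ((openConn c s₁)ᶜ ∩ (openConn c s₀)ᶜ : Set (BondConfig (Fin n))) := by
    rw [hU, Set.compl_union]
  rw [hC, hU (fun s => (openConn s b : Set (BondConfig (Fin n)))), hU (fun s => (openConn o s : Set (BondConfig (Fin n)))),
    hU (fun s => (openConn c s : Set (BondConfig (Fin n))))]
  exact hK2 n w o b s₁ s₀ c hτ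

/-- **(K₀) for `|S| = 2` + (K₀-set) for `|S| ≥ 3` give (K₀-set) for every `|S| ≥ 2`** (card split; `|S| = 2` by
`k0set_pair_of_k0`). [cite: KozmaNitzan2024, Lemma 4 (p. 9)] -/
theorem k0set2_of_k0_k0set3
    (hK2 : ∀ (n : ℕ) (w : Sym2 (Fin n) → unitInterval) (o b a₁ a₂ c : Fin n),
      (prodBernoulli w).real (openConn a₂ b) ≤ (prodBernoulli w).real (openConn a₁ b) →
      (prodBernoulli w).real ((openConn c a₁)ᶜ ∩ (openConn c a₂)ᶜ ∩ openConn o c) *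
          ((prodBernoulli w).real (openConn a₁ b ∪ openConn a₂ b) - (prodBernoulli w).real (openConn a₂ b) -
            (prodBernoulli w).real ((openConn c b)ᶜ ∩ (openConn c a₁ ∪ openConn c a₂) ∩ (openConn a₁ b ∪ openConn a₂ b))) ≤
        (prodBernoulli w).real ((openConn c a₁)ᶜ ∩ (openConn c a₂)ᶜ : Set (BondConfig (Fin n))) *
          ((prodBernoulli w).real (openConn a₁ b ∪ openConn a₂ b) - (prodBernoulli w).real (openConn a₂ b) -
            (prodBernoulli w).real ((openConn o b)ᶜ ∩ (openConn o a₁ ∪ openConn o a₂) ∩ (openConn a₁ b ∪ openConn a₂ b))))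
    (hK3 : ∀ (n : ℕ) (w : Sym2 (Fin n) → unitInterval) (S : Finset (Fin n)) (o b c s₀ : Fin n), 3 ≤ S.card → s₀ ∈ S → c ∉ S →
      (∀ s ∈ S, (prodBernoulli w).real (openConn s₀ b) ≤ (prodBernoulli w).real (openConn s b)) →
      (prodBernoulli w).real ((⋃ s ∈ S, (openConn c s : Set (BondConfig (Fin n))))ᶜ ∩ openConn o c) *
          ((prodBernoulli w).real (⋃ s ∈ S, (openConn s b : Set (BondConfig (Fin n)))) -
            (prodBernoulli w).real (openConn s₀ b) -
            (prodBernoulli w).real ((openConn c b)ᶜ ∩ (⋃ s ∈ S, (openConn c s : Set (BondConfig (Fin n)))) ∩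
              (⋃ s ∈ S, (openConn s b : Set (BondConfig (Fin n)))))) ≤
        (prodBernoulli w).real ((⋃ s ∈ S, (openConn c s : Set (BondConfig (Fin n))))ᶜ) *
          ((prodBernoulli w).real (⋃ s ∈ S, (openConn s b : Set (BondConfig (Fin n)))) -
            (prodBernoulli w).real (openConn s₀ b) -
            (prodBernoulli w).real ((openConn o b)ᶜ ∩ (⋃ s ∈ S, (openConn o s : Set (BondConfig (Fin n)))) ∩
              (⋃ s ∈ S, (openConn s b : Set (BondConfig (Fin n))))))) :
    ∀ (n : ℕ) (w : Sym2 (Fin n) → unitInterval) (S : Finset (Fin n)) (o b c s₀ : Fin n), 2 ≤ S.card → s₀ ∈ S → c ∉ S →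
      (∀ s ∈ S, (prodBernoulli w).real (openConn s₀ b) ≤ (prodBernoulli w).real (openConn s b)) →
      (prodBernoulli w).real ((⋃ s ∈ S, (openConn c s : Set (BondConfig (Fin n))))ᶜ ∩ openConn o c) *
          ((prodBernoulli w).real (⋃ s ∈ S, (openConn s b : Set (BondConfig (Fin n)))) -
            (prodBernoulli w).real (openConn s₀ b) -
            (prodBernoulli w).real ((openConn c b)ᶜ ∩ (⋃ s ∈ S, (openConn c s : Set (BondConfig (Fin n)))) ∩
              (⋃ s ∈ S, (openConn s b : Set (BondConfig (Fin n)))))) ≤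
        (prodBernoulli w).real ((⋃ s ∈ S, (openConn c s : Set (BondConfig (Fin n))))ᶜ) *
          ((prodBernoulli w).real (⋃ s ∈ S, (openConn s b : Set (BondConfig (Fin n)))) -
            (prodBernoulli w).real (openConn s₀ b) -
            (prodBernoulli w).real ((openConn o b)ᶜ ∩ (⋃ s ∈ S, (openConn o s : Set (BondConfig (Fin n)))) ∩
              (⋃ s ∈ S, (openConn s b : Set (BondConfig (Fin n)))))) := by
  intro n w S o b c s₀ h2 hs₀ hc hmin
  rcases Nat.lt_or_ge S.card 3 with hlt | h3
  · -- `|S| = 2`, `S = {s₀, s₁}`: the registered pair kernel (K₀)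
    have hS2 : S.card = 2 := by omega
    obtain ⟨x, y, _, hSxy⟩ := Finset.card_eq_two.1 hS2
    have hs₀xy : s₀ = x ∨ s₀ = y := by
      have : s₀ ∈ ({x, y} : Finset (Fin n)) := hSxy ▸ hs₀
      simpa [Finset.mem_insert, Finset.mem_singleton] using this
    obtain ⟨s₁, hS01⟩ : ∃ s₁ : Fin n, S = {s₀, s₁} := by
      rcases hs₀xy with h | h
      · exact ⟨y, by rw [hSxy, h]⟩
      · exact ⟨x, by rw [hSxy, h, Finset.pair_comm]⟩
    have hs₁S : s₁ ∈ S := by rw [hS01]; simp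
    rw [hS01]
    exact k0set_pair_of_k0 hK2 w o b c s₀ s₁ (hmin s₁ hs₁S)
  · exact hK3 n w S o b c s₀ h3 hs₀ hc hmin

/-- **(K₀-set) ⟹ `AdditiveGluing`.**  The set-gluing slack-inheritance kernel, for every weighted graph, glued set `S`, spectator
`c ∉ S`, observer `o`, target `b` and minimiser `s₀` of `τ` on `S`, implies the crux for every number of relays
(`additiveGluing_of_half_k0set2` + `setGlue_half`).  Its `|S| = 2` instances are the registered kernel `stub_k0_dp` of line `tieline`.
[cite: KozmaNitzan2024, Conjecture 1 (p. 3), Theorem 1 (pp. 7–8), Lemma 4 (p. 9), Question 7 (p. 36), §5.3 (p. 34)] -/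
theorem additiveGluing_of_k0set
    (hK : ∀ (n : ℕ) (w : Sym2 (Fin n) → unitInterval) (S : Finset (Fin n)) (o b c s₀ : Fin n), s₀ ∈ S → c ∉ S →
      (∀ s ∈ S, (prodBernoulli w).real (openConn s₀ b) ≤ (prodBernoulli w).real (openConn s b)) →
      (prodBernoulli w).real ((⋃ s ∈ S, (openConn c s : Set (BondConfig (Fin n))))ᶜ ∩ openConn o c) *
          ((prodBernoulli w).real (⋃ s ∈ S, (openConn s b : Set (BondConfig (Fin n)))) -
            (prodBernoulli w).real (openConn s₀ b) -
            (prodBernoulli w).real ((openConn c b)ᶜ ∩ (⋃ s ∈ S, (openConn c s : Set (BondConfig (Fin n)))) ∩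
              (⋃ s ∈ S, (openConn s b : Set (BondConfig (Fin n)))))) ≤
        (prodBernoulli w).real ((⋃ s ∈ S, (openConn c s : Set (BondConfig (Fin n))))ᶜ) *
          ((prodBernoulli w).real (⋃ s ∈ S, (openConn s b : Set (BondConfig (Fin n)))) -
            (prodBernoulli w).real (openConn s₀ b) -
            (prodBernoulli w).real ((openConn o b)ᶜ ∩ (⋃ s ∈ S, (openConn o s : Set (BondConfig (Fin n)))) ∩
              (⋃ s ∈ S, (openConn s b : Set (BondConfig (Fin n))))))) :
    Summit.CriticalPhenomena.PercolationContinuityZ3.Theses.PercNearOneGluing.AdditiveGluing :=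
  additiveGluing_of_half_k0set2 setGlue_half fun n w S o b c s₀ _ hs₀ hc hmin => hK n w S o b c s₀ hs₀ hc hmin

/-- **(K₀) [`|S| = 2`, the registered `stub_k0_dp`] + (K₀-set) [`|S| ≥ 3`] ⟹ `AdditiveGluing`**: the two-stub form of the proposed
skeleton v22 of line `tieline`. [cite: KozmaNitzan2024, Conjecture 1 (p. 3), Theorem 1 (pp. 7–8), Lemma 4 (p. 9), Question 7 (p. 36)] -/
theorem additiveGluing_of_k0_k0set3
    (hK2 : ∀ (n : ℕ) (w : Sym2 (Fin n) → unitInterval) (o b a₁ a₂ c : Fin n),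
      (prodBernoulli w).real (openConn a₂ b) ≤ (prodBernoulli w).real (openConn a₁ b) →
      (prodBernoulli w).real ((openConn c a₁)ᶜ ∩ (openConn c a₂)ᶜ ∩ openConn o c) *
          ((prodBernoulli w).real (openConn a₁ b ∪ openConn a₂ b) - (prodBernoulli w).real (openConn a₂ b) -
            (prodBernoulli w).real ((openConn c b)ᶜ ∩ (openConn c a₁ ∪ openConn c a₂) ∩ (openConn a₁ b ∪ openConn a₂ b))) ≤
        (prodBernoulli w).real ((openConn c a₁)ᶜ ∩ (openConn c a₂)ᶜ : Set (BondConfig (Fin n))) *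
          ((prodBernoulli w).real (openConn a₁ b ∪ openConn a₂ b) - (prodBernoulli w).real (openConn a₂ b) -
            (prodBernoulli w).real ((openConn o b)ᶜ ∩ (openConn o a₁ ∪ openConn o a₂) ∩ (openConn a₁ b ∪ openConn a₂ b))))
    (hK3 : ∀ (n : ℕ) (w : Sym2 (Fin n) → unitInterval) (S : Finset (Fin n)) (o b c s₀ : Fin n), 3 ≤ S.card → s₀ ∈ S → c ∉ S →
      (∀ s ∈ S, (prodBernoulli w).real (openConn s₀ b) ≤ (prodBernoulli w).real (openConn s b)) →
      (prodBernoulli w).real ((⋃ s ∈ S, (openConn c s : Set (BondConfig (Fin n))))ᶜ ∩ openConn o c) *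
          ((prodBernoulli w).real (⋃ s ∈ S, (openConn s b : Set (BondConfig (Fin n)))) -
            (prodBernoulli w).real (openConn s₀ b) -
            (prodBernoulli w).real ((openConn c b)ᶜ ∩ (⋃ s ∈ S, (openConn c s : Set (BondConfig (Fin n)))) ∩
              (⋃ s ∈ S, (openConn s b : Set (BondConfig (Fin n)))))) ≤
        (prodBernoulli w).real ((⋃ s ∈ S, (openConn c s : Set (BondConfig (Fin n))))ᶜ) *
          ((prodBernoulli w).real (⋃ s ∈ S, (openConn s b : Set (BondConfig (Fin n)))) -
            (prodBernoulli w).real (openConn s₀ b) -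
            (prodBernoulli w).real ((openConn o b)ᶜ ∩ (⋃ s ∈ S, (openConn o s : Set (BondConfig (Fin n)))) ∩
              (⋃ s ∈ S, (openConn s b : Set (BondConfig (Fin n))))))) :
    Summit.CriticalPhenomena.PercolationContinuityZ3.Theses.PercNearOneGluing.AdditiveGluing :=
  additiveGluing_of_half_k0set2 setGlue_half (k0set2_of_k0_k0set3 hK2 hK3)

end

end Summit.CriticalPhenomena.PercolationContinuityZ3.Theorems
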